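import Summits.Ventures.DiscreteObjects.Hadamard.SignedCycleKernelDim
import Summits.Ventures.DiscreteObjects.Hadamard.IsometryCodeParity

/-!
# The exact kernel count on a class of signed cycles of constant length and sign (kernel)

Framing: lottery ticket; floor = certified bounds/negative ranges.

Cell pub-namedobj (venture DiscreteObjects), target (H), hadamard gen 15.  For the signed pull-back `T` of a signed permutation
`(κ, e)` over a field `F` (`(T v) j = e j · v (κ j)`), a `κ`-stable finset `S` on which every point lies on a cycle of
length exactly `L` (`κ^L j = j`, no shorter return) with constant cycle sign `ε = ∏_{i<L} e(κ^i j)`, and a coprime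
factorisation `h · g = X^L - C ε`:

**`cycleClass_count`**: `L · dim (ker h(T) ∩ V_S) = deg h · |S|`, i.e. every such cycle contributes exactly `deg h`
dimensions to `ker h(T)` (`V_S = {v | v = 0 off S}`).

Ingredients: `exists_cycle_reps` (orbit representatives `R ⊆ S`, `|S| = L·|R|`, every point is `κ^t r`);
`finrank_ker_inf_supp_le` (UPPER BOUND `dim (ker f(T) ∩ V_S) ≤ deg f · |R|` for any `f ≠ 0`: a kernel vector supported on
`S` is determined by its values at `deg f` consecutive points of each cycle, because `f(T) v = 0` is a linear recurrence of
order `deg f` along the cycle); and `V_S ⊆ (ker h(T) ∩ V_S) ⊕ (ker g(T) ∩ V_S)` (Bezout), so the two upper bounds are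
attained.  Elementary; ours; no `sorry`.
-/

open Polynomial Finset BigOperators Matrix

namespace Summit.Ventures.DiscreteObjects.Hadamard

variable {F : Type*} [Field F] {ι : Type*} [Fintype ι] [DecidableEq ι]

section reps
variable (κ : Equiv.Perm ι)

omit [Fintype ι] [DecidableEq ι] in
/-- powers of `κ` preserve a `κ`-stable finset -/
lemma pow_apply_mem_iff (S : Finset ι) (hS : ∀ j, κ j ∈ S ↔ j ∈ S) (t : ℕ) (j : ι) : (κ ^ t) j ∈ S ↔ j ∈ S := by
  induction t generalizing j with
  | zero => simp
  | succ t ih => rw [pow_succ', Equiv.Perm.mul_apply, hS, ih]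

omit [Fintype ι] [DecidableEq ι] in
/-- injectivity of `t ↦ κ^t j` below the cycle length (no short returns on `S`) -/
lemma pow_apply_injOn (S : Finset ι) (hS : ∀ j, κ j ∈ S ↔ j ∈ S) {L : ℕ}
    (hmin : ∀ j ∈ S, ∀ t, 0 < t → t < L → (κ ^ t) j ≠ j) {j : ι} (hj : j ∈ S) {s t : ℕ} (hs : s < L)
    (ht : t < L) (h : (κ ^ s) j = (κ ^ t) j) : s = t := by
  by_contra hne
  rcases Nat.lt_or_gt_of_ne hne with hlt | hlt
  · have hx : (κ ^ s) j ∈ S := (pow_apply_mem_iff κ S hS s j).mpr hj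
    apply hmin _ hx (t - s) (by omega) (by omega)
    rw [← Equiv.Perm.mul_apply, ← pow_add, Nat.sub_add_cancel hlt.le, ← h]
  · have hx : (κ ^ t) j ∈ S := (pow_apply_mem_iff κ S hS t j).mpr hj
    apply hmin _ hx (s - t) (by omega) (by omega)
    rw [← Equiv.Perm.mul_apply, ← pow_add, Nat.sub_add_cancel hlt.le, h]

/-- **Cycle representatives.**  For a `κ`-stable finset `S` whose points all lie on cycles of length exactly `L`, there is
`R ⊆ S` with `|S| = L · |R|` such that every point of `S` is `κ^t r` with `r ∈ R`, `t < L`. -/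
theorem exists_cycle_reps (S : Finset ι) (hS : ∀ j, κ j ∈ S ↔ j ∈ S) {L : ℕ} (hL : 0 < L)
    (hper : ∀ j ∈ S, (κ ^ L) j = j) (hmin : ∀ j ∈ S, ∀ t, 0 < t → t < L → (κ ^ t) j ≠ j) :
    ∃ R : Finset ι, R ⊆ S ∧ S.card = L * R.card ∧ ∀ j ∈ S, ∃ r ∈ R, ∃ t, t < L ∧ j = (κ ^ t) r := by
  classical
  letI : LinearOrder ι := LinearOrder.lift' (Fintype.equivFin ι) (Fintype.equivFin ι).injective
  have hpowS := pow_apply_mem_iff κ S hS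
  -- orbit finsets and their minima
  set orb : ι → Finset ι := fun j => (range L).image fun t => (κ ^ t) j with horb
  have horb_iff : ∀ j x, x ∈ orb j ↔ ∃ t, t < L ∧ x = (κ ^ t) j := fun j x => by
    simp only [horb, mem_image, mem_range]
    exact ⟨fun ⟨t, ht, e⟩ => ⟨t, ht, e.symm⟩, fun ⟨t, ht, e⟩ => ⟨t, ht, e.symm⟩⟩
  have horb_ne : ∀ j, (orb j).Nonempty := fun j =>
    ⟨j, (horb_iff j j).mpr ⟨0, hL, by rw [pow_zero, Equiv.Perm.one_apply]⟩⟩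
  set m : ι → ι := fun j => (orb j).min' (horb_ne j) with hm
  have hm_mem : ∀ j, ∃ t, t < L ∧ m j = (κ ^ t) j := fun j => (horb_iff j _).mp (Finset.min'_mem _ (horb_ne j))
  have hm_le : ∀ j x, x ∈ orb j → m j ≤ x := fun j x hx => Finset.min'_le _ _ hx
  have horb_κ : ∀ j ∈ S, orb (κ j) = orb j := by
    intro j hj
    ext x
    rw [horb_iff, horb_iff]
    constructor
    · rintro ⟨t, ht, rfl⟩
      by_cases h : t + 1 < L
      · exact ⟨t + 1, h, by rw [pow_succ, Equiv.Perm.mul_apply]⟩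
      · refine ⟨0, hL, ?_⟩
        have : t + 1 = L := by omega
        rw [pow_zero, Equiv.Perm.one_apply, ← Equiv.Perm.mul_apply, ← pow_succ, this, hper j hj]
    · rintro ⟨t, ht, rfl⟩
      rcases Nat.eq_zero_or_pos t with rfl | htpos
      · refine ⟨L - 1, by omega, ?_⟩
        rw [pow_zero, Equiv.Perm.one_apply, ← Equiv.Perm.mul_apply, ← pow_succ, Nat.sub_add_cancel hL, hper j hj]
      · exact ⟨t - 1, by omega, by rw [← Equiv.Perm.mul_apply, ← pow_succ, Nat.sub_add_cancel htpos]⟩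
  have hm_κ : ∀ j ∈ S, m (κ j) = m j := by
    intro j hj
    apply le_antisymm
    · apply hm_le
      rw [horb_κ j hj]
      exact Finset.min'_mem _ _
    · apply hm_le
      rw [← horb_κ j hj]
      exact Finset.min'_mem _ _
  have hm_pow : ∀ (t : ℕ), ∀ j ∈ S, m ((κ ^ t) j) = m j := by
    intro t
    induction t with
    | zero => intro j _; rw [pow_zero, Equiv.Perm.one_apply]
    | succ t ih => intro j hj; rw [pow_succ', Equiv.Perm.mul_apply, hm_κ _ ((hpowS t j).mpr hj), ih j hj]
  have hm_S : ∀ j ∈ S, m j ∈ S := by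
    intro j hj
    obtain ⟨t, -, e⟩ := hm_mem j
    rw [e]
    exact (hpowS t j).mpr hj
  have hm_idem : ∀ j ∈ S, m (m j) = m j := by
    intro j hj
    obtain ⟨t, -, e⟩ := hm_mem j
    conv_lhs => rw [e]
    exact hm_pow t j hj
  -- representatives = orbit minima
  set R := S.filter (fun c => m c = c) with hR
  have hR_S : R ⊆ S := Finset.filter_subset _ _
  have hcover : ∀ j ∈ S, ∃ r ∈ R, ∃ t, t < L ∧ j = (κ ^ t) r := by
    intro j hj
    refine ⟨m j, Finset.mem_filter.mpr ⟨hm_S j hj, hm_idem j hj⟩, ?_⟩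
    obtain ⟨s, hs, e⟩ := hm_mem j
    rcases Nat.eq_zero_or_pos s with rfl | hspos
    · exact ⟨0, hL, by rw [e, pow_zero, Equiv.Perm.one_apply, Equiv.Perm.one_apply]⟩
    · refine ⟨L - s, by omega, ?_⟩
      rw [e, ← Equiv.Perm.mul_apply, ← pow_add, Nat.sub_add_cancel hs.le, hper j hj]
  refine ⟨R, hR_S, ?_, hcover⟩
  -- counting through the injective parametrisation (t, r) ↦ κ^t r
  have hinj : Set.InjOn (fun x : ℕ × ι => (κ ^ x.1) x.2) ↑(range L ×ˢ R) := by
    rintro ⟨t, r⟩ hx ⟨t', r'⟩ hx' hφ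
    simp only [Finset.coe_product, Set.mem_prod, Finset.mem_coe, mem_range] at hx hx'
    dsimp only at hφ
    obtain ⟨ht, hr⟩ := hx
    obtain ⟨ht', hr'⟩ := hx'
    have hrS : r ∈ S := hR_S hr
    have hr'S : r' ∈ S := hR_S hr'
    have hrr : r = r' := by
      have e1 := hm_pow t r hrS
      have e2 := hm_pow t' r' hr'S
      rw [(Finset.mem_filter.mp hr).2] at e1
      rw [(Finset.mem_filter.mp hr').2] at e2
      rw [← e1, ← e2, hφ]
    subst hrr
    have htt : t = t' := pow_apply_injOn κ S hS hmin hrS ht ht' hφ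
    subst htt
    rfl
  have himage : S = (range L ×ˢ R).image (fun x : ℕ × ι => (κ ^ x.1) x.2) := by
    ext j
    rw [mem_image]
    constructor
    · intro hj
      obtain ⟨r, hr, t, ht, e⟩ := hcover j hj
      exact ⟨(t, r), Finset.mem_product.mpr ⟨mem_range.mpr ht, hr⟩, e.symm⟩
    · rintro ⟨⟨t, r⟩, hx, rfl⟩
      obtain ⟨-, hr⟩ := Finset.mem_product.mp hx
      exact (hpowS t r).mpr (hR_S hr)
  conv_lhs => rw [himage]
  rw [Finset.card_image_of_injOn hinj, Finset.card_product, Finset.card_range]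

end reps

section upper
variable (κ : Equiv.Perm ι) (ee : ι → F) (Kt : Matrix ι ι F)

/-- **Upper bound by the recurrence.**  If every point of `S` is `κ^t r` for some `r ∈ R`, then for `f ≠ 0`:
`dim (ker f(T) ∩ V_S) ≤ deg f · |R|` — a kernel vector supported on `S` is determined by its values at the `deg f` points
`κ^s r`, `s < deg f`, of each `r ∈ R`. -/
theorem finrank_ker_inf_supp_le (hee : ∀ j, ee j * ee j = 1)
    (hKt : Kt = Matrix.of fun j k => if k = κ j then ee j else 0) {f : F[X]} (hf : f ≠ 0) (S R : Finset ι)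
    (hcover : ∀ j ∈ S, ∃ r ∈ R, ∃ t : ℕ, j = (κ ^ t) r) :
    Module.finrank F ↥(LinearMap.ker (aeval (Matrix.toLinAlgEquiv' Kt) f) ⊓
        Submodule.pi {j | j ∉ S} (fun _ => (⊥ : Submodule F F))) ≤ f.natDegree * R.card := by
  set T : (ι → F) →ₗ[F] (ι → F) := Matrix.toLinAlgEquiv' Kt with hT
  set W := LinearMap.ker (aeval T f) ⊓ Submodule.pi {j | j ∉ S} (fun _ => (⊥ : Submodule F F)) with hW
  set d := f.natDegree with hd
  have hne : ∀ j, ee j ≠ 0 := fun j h0 => by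
    have := hee j
    rw [h0, zero_mul] at this
    exact zero_ne_one this
  have hlead : f.coeff d ≠ 0 := by
    rw [hd, Polynomial.coeff_natDegree]
    exact Polynomial.leadingCoeff_ne_zero.mpr hf
  -- the restriction map to the first `d` points of each representative's cycle
  let ρ : ↥W →ₗ[F] (↥R × Fin d → F) :=
    { toFun := fun v x => (v : ι → F) ((κ ^ (x.2 : ℕ)) (x.1 : ι))
      map_add' := fun v w => rfl
      map_smul' := fun c v => rfl }
  have hρ : Function.Injective ρ := by
    intro v w hvw
    rw [← sub_eq_zero] at hvw ⊢
    rw [← map_sub] at hvw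
    set u := v - w with hu
    -- u ∈ W with ρ u = 0 forces u = 0
    have huK : aeval T f (u : ι → F) = 0 := LinearMap.mem_ker.mp (Submodule.mem_inf.mp u.2).1
    have huS := (mem_supp_iff S (u : ι → F)).mp (Submodule.mem_inf.mp u.2).2
    have hρu : ∀ r ∈ R, ∀ s, s < d → (u : ι → F) ((κ ^ s) r) = 0 := fun r hr s hs =>
      congrFun hvw (⟨r, hr⟩, ⟨s, hs⟩)
    have hall : ∀ r ∈ R, ∀ t : ℕ, (u : ι → F) ((κ ^ t) r) = 0 := by
      intro r hr t
      induction t using Nat.strong_induction_on with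
      | _ t ih =>
        by_cases ht : t < d
        · exact hρu r hr t ht
        · obtain ⟨u', hu'⟩ : ∃ u', t = d + u' := ⟨t - d, by omega⟩
          have key := congrFun huK ((κ ^ u') r)
          rw [Pi.zero_apply, hT, signedPullback_aeval_apply κ ee Kt hKt, ← hd, Finset.sum_range_succ,
            Finset.sum_eq_zero, zero_add] at key
          · rw [← Equiv.Perm.mul_apply, ← pow_add, ← hu'] at key
            rcases mul_eq_zero.mp key with h1 | h2
            · exact absurd h1 hlead
            · rcases mul_eq_zero.mp h2 with h3 | h4
              · exact absurd h3 (Finset.prod_ne_zero_iff.mpr fun i _ => hne _)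
              · exact h4
          · intro k hk
            rw [← Equiv.Perm.mul_apply, ← pow_add, ih (k + u') (by rw [mem_range] at hk; omega), mul_zero, mul_zero]
    apply Subtype.ext
    funext k
    by_cases hk : k ∈ S
    · obtain ⟨r, hr, t, e⟩ := hcover k hk
      rw [e]
      exact hall r hr t
    · exact huS k hk
  have h1 := LinearMap.finrank_le_finrank_of_injective hρ
  rw [Module.finrank_fintype_fun_eq_card, Fintype.card_prod, Fintype.card_coe, Fintype.card_fin] at h1
  rw [mul_comm]
  exact h1

end upper

section count
variable (κ : Equiv.Perm ι) (ee : ι → F) (Kt : Matrix ι ι F)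

/-- Bezout decomposition of one vector killed by `(h g)(T)` -/
lemma bezout_split_apply {M : Type*} [AddCommGroup M] [Module F M] (T : M →ₗ[F] M) {h g a b : F[X]}
    (hab : a * h + b * g = 1) (v : M) (hz : aeval T (h * g) v = 0) :
    v = aeval T (b * g) v + aeval T (a * h) v ∧ aeval T h (aeval T (b * g) v) = 0 ∧
      aeval T g (aeval T (a * h) v) = 0 := by
  refine ⟨?_, ?_, ?_⟩
  · have e := congrArg (fun p => aeval T p v) hab
    simp only [map_add, map_one, LinearMap.add_apply, Module.End.one_apply] at e
    rw [add_comm] at e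
    exact e.symm
  · rw [← Module.End.mul_apply, ← map_mul, show h * (b * g) = b * (h * g) by ring, map_mul, Module.End.mul_apply, hz,
      map_zero]
  · rw [← Module.End.mul_apply, ← map_mul, show g * (a * h) = a * (h * g) by ring, map_mul, Module.End.mul_apply, hz,
      map_zero]

/-- **The class count.**  On a `κ`-stable finset `S` of points on cycles of length exactly `L` with constant cycle sign `ε`,
for a coprime factorisation `h g = X^L - C ε`: `L · dim (ker h(T) ∩ V_S) = deg h · |S|`. -/
theorem cycleClass_count (hee : ∀ j, ee j * ee j = 1)
    (hKt : Kt = Matrix.of fun j k => if k = κ j then ee j else 0) (S : Finset ι) (hS : ∀ j, κ j ∈ S ↔ j ∈ S)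
    {L : ℕ} (hL : 0 < L) (hper : ∀ j ∈ S, (κ ^ L) j = j) (hmin : ∀ j ∈ S, ∀ t, 0 < t → t < L → (κ ^ t) j ≠ j)
    {ε : F} (hε : ∀ j ∈ S, ∏ i ∈ range L, ee ((κ ^ i) j) = ε) {h g : F[X]} (hhg : h * g = X ^ L - C ε)
    (hcop : IsCoprime h g) :
    L * Module.finrank F ↥(LinearMap.ker (aeval (Matrix.toLinAlgEquiv' Kt) h) ⊓
        Submodule.pi {j | j ∉ S} (fun _ => (⊥ : Submodule F F))) = h.natDegree * S.card := by
  set T : (ι → F) →ₗ[F] (ι → F) := Matrix.toLinAlgEquiv' Kt with hT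
  set VS := Submodule.pi {j | j ∉ S} (fun _ => (⊥ : Submodule F F)) with hVS
  set Wh := LinearMap.ker (aeval T h) ⊓ VS with hWh
  set Wg := LinearMap.ker (aeval T g) ⊓ VS with hWg
  obtain ⟨R, hRS, hcard, hcover⟩ := exists_cycle_reps κ S hS hL hper hmin
  -- degrees
  have hXne : (X ^ L - C ε : F[X]) ≠ 0 := X_pow_sub_C_ne_zero hL ε
  have hh0 : h ≠ 0 := fun h0 => hXne (by rw [← hhg, h0, zero_mul])
  have hg0 : g ≠ 0 := fun h0 => hXne (by rw [← hhg, h0, mul_zero])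
  have hdeg : h.natDegree + g.natDegree = L := by
    rw [← natDegree_mul hh0 hg0, hhg, natDegree_X_pow_sub_C]
  -- upper bounds
  have hcover' : ∀ j ∈ S, ∃ r ∈ R, ∃ t : ℕ, j = (κ ^ t) r := fun j hj => by
    obtain ⟨r, hr, t, -, e⟩ := hcover j hj
    exact ⟨r, hr, t, e⟩
  have hubh : Module.finrank F ↥Wh ≤ h.natDegree * R.card :=
    finrank_ker_inf_supp_le κ ee Kt hee hKt hh0 S R hcover'
  have hubg : Module.finrank F ↥Wg ≤ g.natDegree * R.card :=
    finrank_ker_inf_supp_le κ ee Kt hee hKt hg0 S R hcover'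
  -- V_S ≤ Wh ⊔ Wg
  have hVT : ∀ v ∈ VS, T v ∈ VS := by
    intro v hv
    rw [mem_supp_iff] at hv ⊢
    intro j hj
    rw [hT, Matrix.toLinAlgEquiv'_apply, signedPullback_mulVec κ ee Kt hKt, hv (κ j) (fun h' => hj ((hS j).mp h')),
      mul_zero]
  obtain ⟨a, b, hab⟩ := hcop
  have hle : VS ≤ Wh ⊔ Wg := by
    intro v hv
    have hvS := (mem_supp_iff S v).mp hv
    have hz : aeval T (h * g) v = 0 := by
      rw [hhg]
      funext j
      rw [hT, signedPullback_X_pow_sub_C_apply κ ee Kt hKt, Pi.zero_apply]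
      by_cases hj : j ∈ S
      · rw [hper j hj, hε j hj, sub_self]
      · rw [hvS j hj, hvS _ (fun h' => hj ((pow_apply_mem_iff κ S hS L j).mp h')), mul_zero, mul_zero, sub_self]
    obtain ⟨e1, h1, h2⟩ := bezout_split_apply T hab v hz
    rw [e1]
    exact Submodule.add_mem_sup
      (Submodule.mem_inf.mpr ⟨LinearMap.mem_ker.mpr h1, aeval_mem_of_invariant T VS hVT _ hv⟩)
      (Submodule.mem_inf.mpr ⟨LinearMap.mem_ker.mpr h2, aeval_mem_of_invariant T VS hVT _ hv⟩)
  -- disjointness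
  have hdisj : Wh ⊓ Wg = ⊥ := by
    have h0 := (disjoint_ker_aeval_of_isCoprime T (⟨a, b, hab⟩ : IsCoprime h g)).eq_bot
    rw [eq_bot_iff] at h0 ⊢
    intro v hv
    apply h0
    exact Submodule.mem_inf.mpr
      ⟨(Submodule.mem_inf.mp (Submodule.mem_inf.mp hv).1).1, (Submodule.mem_inf.mp (Submodule.mem_inf.mp hv).2).1⟩
  -- |S| ≤ dim V_S (the coordinate vectors of S lie in V_S)
  have hcardle : S.card ≤ Module.finrank F ↥VS := by
    have hmem : ∀ j : ↥S, (Pi.single (j : ι) (1 : F) : ι → F) ∈ VS := fun j =>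
      (mem_supp_iff S _).mpr fun k hk => Pi.single_eq_of_ne (fun e : k = (j : ι) => hk (by rw [e]; exact j.2)) _
    have hli0 : LinearIndependent F (fun j : ↥S => (Pi.single (j : ι) (1 : F) : ι → F)) := by
      have e := (Pi.basisFun F ι).linearIndependent.comp (fun j : ↥S => (j : ι)) Subtype.val_injective
      refine (linearIndependent_equiv' (Equiv.refl _) ?_).mp e
      funext j
      simp [Pi.basisFun_apply]
    have hli : LinearIndependent F (fun j : ↥S => (⟨Pi.single (j : ι) (1 : F), hmem j⟩ : ↥VS)) :=
      LinearIndependent.of_comp VS.subtype hli0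
    have e := hli.fintype_card_le_finrank
    rwa [Fintype.card_coe] at e
  -- combine
  have hsup := Submodule.finrank_sup_add_finrank_inf_eq Wh Wg
  rw [hdisj, finrank_bot, add_zero] at hsup
  have hmono := Submodule.finrank_mono hle
  have hAB : S.card = h.natDegree * R.card + g.natDegree * R.card := by
    rw [hcard, ← hdeg, Nat.add_mul]
  have key : Module.finrank F ↥Wh = h.natDegree * R.card := by omega
  rw [key, hcard]
  ring

end count

end Summit.Ventures.DiscreteObjects.Hadamard
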